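import Literature.Analysis.FluidPDE.TsaiLocalEnergyProofs
import Literature.Analysis.FluidPDE.CKNPressureEstimateForce
import Literature.Analysis.FluidPDE.CKNLocalEnergyEstimate
import Literature.Analysis.FluidPDE.CKNEpsilonRegularityHolds
import HarnessLib

/-!
# Tsai 1998, Lemma 4.2 WITH A FORCE (backward ε-regularity at the top of a cylinder), unit
  viscosity, solenoidal force

Analysis/FluidPDE proofs file (no definitions, no named facts). T.-P. Tsai, *On Leray's
self-similar solutions of the Navier–Stokes equations satisfying local energy estimates*, Arch.
Rational Mech. Anal. 143 (1998) 29–51, **Lemma 4.2** (p. 46) is Caffarelli–Kohn–Nirenberg's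
ε-regularity criterion in terms of the gradient (CKN 1982, **Proposition 2**) with the BACKWARD
cylinders `Q_r(x, t)` in place of the centred ones — so that it applies at the TOP `t = T` of a
cylinder `Q_ρ(T, x₀)` carrying the hypotheses. Tsai prints it for the unforced equations (his
(1.1)); Caffarelli–Kohn–Nirenberg's Proposition 2 carries a force `f ∈ L^q`, `q > 5/2`, with
`div f = 0` ((2.3′)). The tree proves the unforced backward statement
(`tsai1998_lemma42_unit_of_estimates`, `TsaiLocalEnergyProofs`). This file proves the same
backward statement WITH A FORCE, at unit viscosity, in the vocabulary in which the tree's decay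
estimates and one-scale criterion are stated with force — Lemarié-Rieusset's §14.3 class
`IsLRSuitableWeakSolutionOn Q 1 3 f u p G` (force exponent `q = 3`) — for a force that is
solenoidal in `𝒟'(Q)` (as in CKN's (2.3′); the pressure estimate needs it):

* `tsai1998_lemma42_forced_unit_of_estimates` — from `localEnergyEstimate`, `pressureEstimate`,
  `interpolationEstimate` and `lemarieRieusset_epsilon_regularity` (all discharged in tree);
* `tsai1998_lemma42_forced_unit` — the same with the four estimates supplied by their `_holds`
  theorems: there is an absolute `ε > 0` such that for every `(Q_ρ(T, x₀), f, u, p, G)` in the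
  §14.3 class with `ν = 1`, `f ∈ L³(Q_ρ(T, x₀))`, `div f = 0`, and every point `z = (t, x)` with
  `T - ρ² < t ≤ T`, `x ∈ B_ρ(x₀)`: `limsup_{r → 0⁺} r⁻¹ ∫∫_{Q_r(z)} |G|² ≤ ε` implies
  `u ∈ L^∞(Q_{r₁}(z))` for some `r₁ > 0`.

The general viscosity and a general (non-solenoidal) `L³` force are treated in
`TsaiTopSingularNullForced` (rescaling + absorption of the gradient part of the force into the
pressure on the unit cylinder, Caffarelli–Kohn–Nirenberg 1982, §1).
`-- TODO(general form): CKN's force class is f ∈ L^q, q > 5/2; here q = 3 (the threshold ε of`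
`-- Lemarié-Rieusset's Thm. 14.4 depends on q, so a q-uniform ε needs the one-scale criterion in`
`-- Caffarelli–Kohn–Nirenberg's form; q = 3 covers every bounded force on a bounded cylinder).`

## The proof

Word for word the tree's proof of the unforced statement (`TsaiLocalEnergyProofs`, module
docstring: shift the centre into the past, run `CKN1982.decay_scheme` uniformly in the shift,
exhaust the top cylinder, apply Thm. 14.4 on the top cylinder), with two additions — exactly the
force bookkeeping of the tree's interior assembly `ckn_epsilon_regularity_of_estimates`:
the force inputs of the scheme are `F₃(s; z') = s⁴ ∫∫_{Q_s(z')} |f|³ ≤ s⁴ ‖f‖³_{L³(Q)}`, smaller than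
the scheme's force threshold `η^{3/2}` once the starting scale `r₀` is below a radius `r_F`
(`exists_forall_ofReal_rpow_mul_lt`); and the force condition of Thm. 14.4 at the last scale,
`∫∫_{Q_{r_f}(z)} |f|³ ≤ ε_L⁶ r_f⁻⁴`, holds for the same reason. In Lemarié-Rieusset's class the weak
gradient `G` of the local energy inequality is the given one, so no a.e. identification of
gradients is needed.

## Mathlib / tree search

Tree (all used): `IsLRSuitableWeakSolutionOn`, `lemarieRieusset_epsilon_regularity_iff`
(`CKNEpsilonRegularityProofs`); `IsLRSuitableWeakSolutionOn.isSuitableWeakSolutionOn`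
(`CKNPressureEstimateForce`); `localEnergyEstimate`, `pressureEstimate`, `interpolationEstimate`,
`cknF`, `cknF_le_of_subset`, `exists_forall_ofReal_rpow_mul_lt`, `real_localEnergy`,
`real_pressure`, `real_interpolation`, `real_force`, `add_le_ofReal_of_real`,
`locallyIntegrableOn_of_memLp`, `closure_parabolicCylinder_subset`, `cknE_le_of_subset`,
`cknD_le_of_subset` (`CKNEpsilonRegularityAssembly`); `CKN1982.decay_scheme` (`CKNDecayScheme`);
`exists_forall_lt_of_limsup_le`, `cknAEss_le_of_energy` (`CKN1982Setting`); `ofReal_two_mul`,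
`inv_ofReal_eq_two_mul_inv`, `isConnected_parabolicCylinder` (`TsaiLocalEnergyProofs`);
`localEnergyEstimate_holds`, `pressureEstimate_holds`, `interpolationEstimate_holds`,
`lemarieRieusset_epsilon_regularity_holds`. `lean search 'lemma42.*forc'`: no hit before this file.

## References

* T.-P. Tsai, *On Leray's self-similar solutions of the Navier–Stokes equations satisfying local
  energy estimates*, Arch. Rational Mech. Anal. 143 (1998) 29–51: Lemma 4.2 (p. 46). [Tsai1998]
* L. Caffarelli, R. Kohn, L. Nirenberg, *Partial regularity of suitable weak solutions of the
  Navier–Stokes equations*, Comm. Pure Appl. Math. 35 (1982) 771–831: (2.3′), Propositions 1–2,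
  §6. [CaffarelliKohnNirenberg1982]
* P. G. Lemarié-Rieusset, *The Navier–Stokes Problem in the 21st Century*, CRC Press (2016):
  §14.3, Thm. 14.4 (p. 505). [LemarieRieusset2016]
* J. C. Robinson, J. L. Rodrigo, W. Sadowski, *The three-dimensional Navier–Stokes equations*,
  CUP (2016): (16.13), Lemma 16.7, (15.31). [RobinsonRodrigoSadowski2016]
-/

noncomputable section

open MeasureTheory Set Function Filter Topology TopologicalSpace Metric
open scoped NNReal ENNReal InnerProductSpace RealInnerProductSpace

namespace Literature.Analysis.FluidPDE

/-! ## Lemma 4.2 with a solenoidal `L³` force at unit viscosity, from the four estimates -/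

/-- **Tsai 1998, Lemma 4.2 with a force, unit viscosity, from the Caffarelli–Kohn–Nirenberg
estimates** (Tsai's backward variant of CKN 1982, Proposition 2, which carries a solenoidal force
`f ∈ L^q`; here `q = 3`). There is `ε > 0` such that for every datum
`(Q_ρ(T, x₀), f, u, p, G)` in Lemarié-Rieusset's §14.3 class with `ν = 1` and force exponent `3`
(`IsLRSuitableWeakSolutionOn`), `div f = 0` in `𝒟'(Q_ρ(T, x₀))`, and every point `z = (t, x)` with
`T - ρ² < t ≤ T`, `x ∈ B_ρ(x₀)`: `limsup_{r→0⁺} r⁻¹ ∫∫_{Q_r(z)} |G|² ≤ ε` implies `u ∈ L^∞(Q_{r₁}(z))`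
for some `r₁ > 0`. Inputs: `localEnergyEstimate`, `pressureEstimate`, `interpolationEstimate`
(run through `CKN1982.decay_scheme` at centres shifted into the past, uniformly in the shift, the
force inputs being small below the radius `r_F`) and `lemarieRieusset_epsilon_regularity`
(applied on the top cylinder `Q_{r_f}(z)` after exhausting it by truncated cylinders).
[cite: Tsai1998, Lemma 4.2 (p. 46)] [cite: CaffarelliKohnNirenberg1982, Proposition 2] -/
theorem tsai1998_lemma42_forced_unit_of_estimates (hLE : localEnergyEstimate)
    (hPE : pressureEstimate) (hIE : interpolationEstimate)
    (hLR : lemarieRieusset_epsilon_regularity) :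
    ∃ ε : ℝ, 0 < ε ∧
    ∀ (ρ T : ℝ) (x₀ : EuclideanSpace ℝ (Fin 3))
      (f u : ℝ → EuclideanSpace ℝ (Fin 3) → EuclideanSpace ℝ (Fin 3))
      (p : ℝ → EuclideanSpace ℝ (Fin 3) → ℝ)
      (G : ℝ → EuclideanSpace ℝ (Fin 3) → EuclideanSpace ℝ (Fin 3) →L[ℝ] EuclideanSpace ℝ (Fin 3)),
      0 < ρ →
      IsLRSuitableWeakSolutionOn (parabolicCylinderOpens ρ (T, x₀)) 1 3 f u p G →
      (∀ φ : ℝ → EuclideanSpace ℝ (Fin 3) → ℝ,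
        IsSpaceTimeTestOn (parabolicCylinderOpens ρ (T, x₀)) φ →
          ∫ t, ∫ x, ⟪f t x, gradient (φ t) x⟫ = 0) →
      ∀ z : ℝ × EuclideanSpace ℝ (Fin 3), z.1 ∈ Ioc (T - ρ ^ 2) T → z.2 ∈ ball x₀ ρ →
        limsup (fun r : ℝ => (ENNReal.ofReal r)⁻¹ *
            ∫⁻ w in parabolicCylinder r z, ENNReal.ofReal (frobeniusNormSq (G w.1 w.2)))
          (𝓝[>] (0 : ℝ)) ≤ ENNReal.ofReal ε →
        ∃ r₁ : ℝ, 0 < r₁ ∧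
          eLpNorm (uncurry u) ⊤ (volume.restrict (parabolicCylinder r₁ z)) < ⊤ := by
  obtain ⟨κ₁, κ₂, κ₃, κ₄, hLE⟩ := hLE
  obtain ⟨κ₅, κ₆, hPE⟩ := hPE
  obtain ⟨C₀, hIE⟩ := hIE
  obtain ⟨εL, CL, hεL, hCL, hLR⟩ :=
    (lemarieRieusset_epsilon_regularity_iff.1 hLR) 1 3 one_pos (by norm_num)
  -- the abstract scheme with the real constants
  obtain ⟨θ, hθ, hθhalf, hscheme⟩ := CKN1982.decay_scheme (κ₁ := (κ₁ : ℝ)) (κ₂ := (κ₂ : ℝ))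
    (κ₃ := (κ₃ : ℝ)) (κ₄ := (κ₄ : ℝ))
    (κ₅ := (2 : ℝ) ^ (1 / 3 : ℝ) * (κ₅ : ℝ) ^ (4 / 3 : ℝ))
    (κ₆ := (2 : ℝ) ^ (1 / 3 : ℝ) * (κ₆ : ℝ) ^ (4 / 3 : ℝ)) (C₀ := (C₀ : ℝ))
    κ₁.coe_nonneg κ₂.coe_nonneg κ₃.coe_nonneg κ₄.coe_nonneg (by positivity) (by positivity)
    C₀.coe_nonneg
  have hθ1 : θ ≤ 1 := hθhalf.trans (by norm_num)
  obtain ⟨ε, hε, η, hη, hsteps⟩ := hscheme (εL ^ 3) (by positivity)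
  refine ⟨ε / 4, by positivity, ?_⟩
  rintro ρ T x₀ f u p G hρ hS hdiv ⟨t, x⟩ hzt hzx hlim
  dsimp only at hzt hzx
  set Q : Opens (ℝ × EuclideanSpace ℝ (Fin 3)) := parabolicCylinderOpens ρ (T, x₀) with hQdef
  have hQ : (Q : Set (ℝ × EuclideanSpace ℝ (Fin 3))) = parabolicCylinder ρ (T, x₀) := rfl
  -- the Caffarelli–Kohn–Nirenberg classes from the §14.3 classes
  have hsws : IsSuitableWeakSolutionOn Q 1 f u p := hS.isSuitableWeakSolutionOn
  have hG : HasWeakSpatialGradientOn Q u G := hS.weakGradient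
  have hloc := hS.localEnergy
  obtain ⟨CE, hCEind⟩ := hS.energyClass
  set F : ℝ × EuclideanSpace ℝ (Fin 3) → ℝ≥0∞ :=
    fun w => ENNReal.ofReal (frobeniusNormSq (G w.1 w.2)) with hF
  have hGint : ∫⁻ w in (Q : Set (ℝ × EuclideanSpace ℝ (Fin 3))), F w < ⊤ := hS.gradient_lt_top
  have hp' : ∫⁻ w in (Q : Set (ℝ × EuclideanSpace ℝ (Fin 3))), ‖p w.1 w.2‖ₑ ^ (3 / 2 : ℝ) < ⊤ :=
    hS.pressure_lt_top
  -- the force: `L³` class, local integrability, and `‖f‖³_{L³(Q)} < ∞`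
  have hfq : MemLp (uncurry f) (ENNReal.ofReal 3)
      (volume.restrict (Q : Set (ℝ × EuclideanSpace ℝ (Fin 3)))) := hS.force_memLp
  have hfli : LocallyIntegrableOn (uncurry f) (Q : Set (ℝ × EuclideanSpace ℝ (Fin 3))) volume :=
    locallyIntegrableOn_of_memLp (by norm_num) hfq
  have hNf : ∫⁻ w in (Q : Set (ℝ × EuclideanSpace ℝ (Fin 3))), ‖f w.1 w.2‖ₑ ^ (3 : ℝ) < ⊤ := by
    have := hfq.2
    rw [eLpNorm_lt_top_iff_lintegral_rpow_enorm_lt_top (by simp) ENNReal.ofReal_ne_top,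
      ENNReal.toReal_ofReal (by norm_num : (0 : ℝ) ≤ 3)] at this
    exact this
  -- ## geometry: the margins of the point `(t, x)` inside `Q`
  have hgt : 0 < t - (T - ρ ^ 2) := sub_pos.2 hzt.1
  have hgx : 0 < ρ - dist x x₀ := sub_pos.2 (mem_ball.1 hzx)
  obtain ⟨r₁, hr₁, hr₁t, hr₁x⟩ : ∃ r₁ : ℝ, 0 < r₁ ∧ 4 * r₁ ^ 2 < t - (T - ρ ^ 2) ∧
      2 * r₁ < ρ - dist x x₀ := by
    set g : ℝ := min (t - (T - ρ ^ 2)) (ρ - dist x x₀) with hg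
    have hg0 : 0 < g := lt_min hgt hgx
    refine ⟨min (g / 4) (1 / 2), by positivity, ?_, ?_⟩
    · have h1 : 2 * min (g / 4) (1 / 2) ≤ g / 2 := by linarith [min_le_left (g / 4) (1 / 2)]
      have h2 : 2 * min (g / 4) (1 / 2) ≤ 1 := by linarith [min_le_right (g / 4) (1 / 2)]
      have h3 : 0 ≤ 2 * min (g / 4) (1 / 2) := by positivity
      calc 4 * min (g / 4) (1 / 2) ^ 2 = (2 * min (g / 4) (1 / 2)) * (2 * min (g / 4) (1 / 2)) := by
            ring
        _ ≤ g / 2 * 1 := mul_le_mul h1 h2 h3 (by positivity)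
        _ < g := by linarith
        _ ≤ t - (T - ρ ^ 2) := min_le_left _ _
    · calc 2 * min (g / 4) (1 / 2) ≤ 2 * (g / 4) := by gcongr; exact min_le_left _ _
        _ < g := by linarith
        _ ≤ ρ - dist x x₀ := min_le_right _ _
  -- shifted cylinders `Q_r(t - h, x)`, `0 < h ≤ r₁²`, `0 < r ≤ r₁`, have closure inside `Q`
  have hclQ : ∀ h r, 0 < h → h ≤ r₁ ^ 2 → 0 < r → r ≤ r₁ →
      closure (parabolicCylinder r (t - h, x)) ⊆ (Q : Set (ℝ × EuclideanSpace ℝ (Fin 3))) := by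
    intro h r hh0 hh hr hrr
    refine (closure_parabolicCylinder_subset r _).trans ?_
    rw [hQ, parabolicCylinder]
    refine prod_mono ?_ ?_
    · intro s hs
      simp only [mem_Icc] at hs
      simp only [mem_Ioo]
      have : r ^ 2 ≤ r₁ ^ 2 := pow_le_pow_left₀ hr.le hrr 2
      constructor <;> nlinarith [hzt.2]
    · exact closedBall_subset_ball' (by simp only; linarith [hrr])
  -- the doubled cylinders `Q_{2r}(t, x)`, `0 < r ≤ r₁`, lie inside `Q`
  have hdblQ : ∀ r, 0 < r → r ≤ r₁ →
      parabolicCylinder (2 * r) (t, x) ⊆ (Q : Set (ℝ × EuclideanSpace ℝ (Fin 3))) := by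
    intro r hr hrr
    rw [hQ, parabolicCylinder, parabolicCylinder]
    refine prod_mono ?_ (ball_subset_ball' (by simp only; linarith))
    simp only
    have : r ^ 2 ≤ r₁ ^ 2 := pow_le_pow_left₀ hr.le hrr 2
    exact Ioo_subset_Ioo (by nlinarith) hzt.2
  -- a shifted cylinder lies in the doubled one: `Q_r(t - h, x) ⊆ Q_{2r}(t, x)` for `0 ≤ h ≤ 3r²`
  have hshift : ∀ h r, 0 ≤ h → 0 < r → h ≤ 3 * r ^ 2 →
      parabolicCylinder r (t - h, x) ⊆ parabolicCylinder (2 * r) (t, x) := by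
    intro h r hh0 hr hh
    rw [parabolicCylinder, parabolicCylinder]
    refine prod_mono ?_ (ball_subset_ball (by linarith))
    simp only
    exact Ioo_subset_Ioo (by nlinarith) (by linarith)
  -- ## the scale `r_E` below which the dissipation around `(t, x)` is `< ε/2`
  obtain ⟨rE, hrE, hElt⟩ := exists_forall_lt_of_limsup_le hlim
    ((ENNReal.ofReal_lt_ofReal_iff (by positivity)).2 (by linarith : ε / 4 < ε / 2))
  -- ## the scale `r_F` below which the force quantities are small
  have hτ : 0 < min (ENNReal.ofReal η ^ ((3 : ℝ) / 2)) (ENNReal.ofReal (εL ^ 6)) :=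
    lt_min (ENNReal.rpow_pos (ENNReal.ofReal_pos.2 hη) ENNReal.ofReal_ne_top)
      (ENNReal.ofReal_pos.2 (by positivity))
  obtain ⟨rF, hrF, hFlt⟩ := exists_forall_ofReal_rpow_mul_lt (s := 3 * (3 : ℝ) - 5) (by norm_num)
    hNf.ne hτ
  -- the starting scale `r₀`
  obtain ⟨r₀, hr₀, hr₀r₁, hr₀E, hr₀F⟩ : ∃ r₀ : ℝ, 0 < r₀ ∧ r₀ ≤ r₁ ∧ 2 * r₀ < rE ∧ r₀ < rF :=
    ⟨min (min r₁ (rE / 4)) (rF / 2), by positivity, (min_le_left _ _).trans (min_le_left _ _),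
      by linarith [(min_le_left (min r₁ (rE / 4)) (rF / 2)).trans (min_le_right r₁ (rE / 4))],
      by linarith [min_le_right (min r₁ (rE / 4)) (rF / 2)]⟩
  -- the a-priori bound `M` and the number of steps `k`
  set Np : ℝ≥0∞ := ∫⁻ w in (Q : Set (ℝ × EuclideanSpace ℝ (Fin 3))), ‖p w.1 w.2‖ₑ ^ (3 / 2 : ℝ)
    with hNp
  obtain ⟨k, hk⟩ := hsteps
    (((ENNReal.ofReal r₀)⁻¹ * CE).toReal + ((((ENNReal.ofReal r₀) ^ 2)⁻¹ * Np) ^ (4 / 3 : ℝ)).toReal)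
  -- the last scale `rf`
  obtain ⟨rf, hrfdef⟩ : ∃ rf : ℝ, rf = θ ^ k * r₀ := ⟨_, rfl⟩
  have hrf : 0 < rf := by rw [hrfdef]; positivity
  have hrfr₀ : rf ≤ r₀ := by
    rw [hrfdef]; exact mul_le_of_le_one_left hr₀.le (pow_le_one₀ hθ.le hθ1)
  have hrfr₁ : rf ≤ r₁ := hrfr₀.trans hr₀r₁
  -- the scales `s j = θʲ r₀`
  have hs0 : ∀ j : ℕ, 0 < θ ^ j * r₀ := fun j => by positivity
  have hsr₀ : ∀ j : ℕ, θ ^ j * r₀ ≤ r₀ := fun j =>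
    mul_le_of_le_one_left hr₀.le (pow_le_one₀ hθ.le hθ1)
  have hsrf : ∀ j ≤ k, rf ≤ θ ^ j * r₀ := fun j hj => by
    rw [hrfdef]
    exact mul_le_mul_of_nonneg_right (pow_le_pow_of_le_one hθ.le hθ1 hj) hr₀.le
  have hsucc : ∀ j : ℕ, θ * (θ ^ j * r₀) = θ ^ (j + 1) * r₀ := fun j => by rw [pow_succ]; ring
  -- ## the decay scheme at the shifted centres `(t - h, x)`, `0 < h ≤ min r₁² (3 rf²)`
  have hstep : ∀ h : ℝ, 0 < h → h ≤ r₁ ^ 2 → h ≤ 3 * rf ^ 2 →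
      cknC rf (t - h, x) u + cknD rf (t - h, x) p ≤ ENNReal.ofReal (εL ^ 3) := by
    intro h hh0 hhr₁ hhrf
    set z' : ℝ × EuclideanSpace ℝ (Fin 3) := (t - h, x) with hz'
    have hclQ' : ∀ r, 0 < r → r ≤ r₀ →
        closure (parabolicCylinder r z') ⊆ (Q : Set (ℝ × EuclideanSpace ℝ (Fin 3))) :=
      fun r hr hrr => hclQ h r hh0 hhr₁ hr (hrr.trans hr₀r₁)
    have hsubQ : ∀ r, 0 < r → r ≤ r₀ →
        parabolicCylinder r z' ⊆ (Q : Set (ℝ × EuclideanSpace ℝ (Fin 3))) :=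
      fun r hr hrr => subset_closure.trans (hclQ' r hr hrr)
    -- finiteness of the scaled quantities at admissible radii
    have hAle : ∀ r, 0 < r → r ≤ r₀ → cknAEss r z' u ≤ (ENNReal.ofReal r)⁻¹ * CE :=
      fun r hr hrr => cknAEss_le_of_energy hCEind (hsubQ r hr hrr)
    have hAfin : ∀ r, 0 < r → r ≤ r₀ → cknAEss r z' u ≠ ⊤ := fun r hr hrr =>
      ne_top_of_le_ne_top (ENNReal.mul_ne_top (ENNReal.inv_ne_top.2 (ENNReal.ofReal_pos.2 hr).ne')
        ENNReal.coe_ne_top) (hAle r hr hrr)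
    have hEfin : ∀ r, 0 < r → r ≤ r₀ → cknE r z' G ≠ ⊤ := fun r hr hrr =>
      ne_top_of_le_ne_top (ENNReal.mul_ne_top (ENNReal.inv_ne_top.2 (ENNReal.ofReal_pos.2 hr).ne')
        hGint.ne) (cknE_le_of_subset G (hsubQ r hr hrr))
    have hDfin : ∀ r, 0 < r → r ≤ r₀ → cknD r z' p ≠ ⊤ := fun r hr hrr =>
      ne_top_of_le_ne_top (ENNReal.mul_ne_top
        (ENNReal.inv_ne_top.2 (pow_ne_zero 2 (ENNReal.ofReal_pos.2 hr).ne')) hp'.ne)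
        (cknD_le_of_subset p (hsubQ r hr hrr))
    have hFle : ∀ r, 0 < r → r ≤ r₀ →
        cknF 3 r z' f < min (ENNReal.ofReal η ^ ((3 : ℝ) / 2)) (ENNReal.ofReal (εL ^ 6)) :=
      fun r hr hrr => lt_of_le_of_lt (cknF_le_of_subset f (hsubQ r hr hrr))
        (hFlt r hr (lt_of_le_of_lt hrr hr₀F))
    have hFfin : ∀ r, 0 < r → r ≤ r₀ → cknF 3 r z' f ≠ ⊤ := fun r hr hrr =>
      ((hFle r hr hrr).trans_le (min_le_right _ _)).ne_top
    have hGr : ∀ r, 0 < r → r ≤ r₀ →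
        HasWeakSpatialGradientOn (parabolicCylinderOpens r z') u G :=
      fun r hr hrr => hG.mono (hsubQ r hr hrr)
    have hCfin : ∀ r, 0 < r → r ≤ r₀ → cknC r z' u ≠ ⊤ := fun r hr hrr =>
      ne_top_of_le_ne_top (ENNReal.mul_ne_top ENNReal.coe_ne_top (ENNReal.rpow_ne_top_of_nonneg
        (by norm_num) (ENNReal.add_ne_top.2 ⟨hAfin r hr hrr, hEfin r hr hrr⟩)))
        (hIE u G z' r hr (hGr r hr hrr) (hAfin r hr hrr) (hEfin r hr hrr))
    -- the dissipation inputs are small: `E(s; z') ≤ 2 E(2s; (t, x)) < ε` for `rf ≤ s ≤ r₀`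
    have hEsmall : ∀ j ≤ k, (cknE (θ ^ j * r₀) z' G).toReal ≤ ε := by
      intro j hj
      have hs := hs0 j
      have hle3 : h ≤ 3 * (θ ^ j * r₀) ^ 2 :=
        hhrf.trans (by nlinarith [hsrf j hj, hrf])
      have h1 : cknE (θ ^ j * r₀) z' G ≤
          2 * ((ENNReal.ofReal (2 * (θ ^ j * r₀)))⁻¹ *
            ∫⁻ w in parabolicCylinder (2 * (θ ^ j * r₀)) (t, x), F w) := by
        have e1 : cknE (θ ^ j * r₀) z' G =
            (ENNReal.ofReal (θ ^ j * r₀))⁻¹ * ∫⁻ w in parabolicCylinder (θ ^ j * r₀) z', F w := by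
          rw [cknE, hF]
        rw [e1, ← mul_assoc, ← inv_ofReal_eq_two_mul_inv]
        exact mul_le_mul_right (lintegral_mono_set (hshift h _ hh0.le hs hle3)) _
      have h2 : (ENNReal.ofReal (2 * (θ ^ j * r₀)))⁻¹ *
          ∫⁻ w in parabolicCylinder (2 * (θ ^ j * r₀)) (t, x), F w < ENNReal.ofReal (ε / 2) :=
        hElt _ (by positivity) (by nlinarith [hsr₀ j])
      refine ENNReal.toReal_le_of_le_ofReal hε.le (h1.trans ?_)
      calc 2 * ((ENNReal.ofReal (2 * (θ ^ j * r₀)))⁻¹ *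
            ∫⁻ w in parabolicCylinder (2 * (θ ^ j * r₀)) (t, x), F w)
          ≤ 2 * ENNReal.ofReal (ε / 2) := mul_le_mul_right h2.le _
        _ = ENNReal.ofReal ε := by rw [← ofReal_two_mul]; congr 1; ring
    -- the real sequences and the scheme
    have hmain := hk (fun j => (cknAEss (θ ^ j * r₀) z' u).toReal)
      (fun j => (cknE (θ ^ j * r₀) z' G).toReal)
      (fun j => (cknD (θ ^ j * r₀) z' p ^ (4 / 3 : ℝ)).toReal)
      (fun j => (cknF 3 (θ ^ j * r₀) z' f ^ (2 / (3 : ℝ))).toReal)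
      ((cknC (θ ^ k * r₀) z' u).toReal)
      (fun j => ENNReal.toReal_nonneg) (fun j => ENNReal.toReal_nonneg)
      (fun j => ENNReal.toReal_nonneg) (fun j => ENNReal.toReal_nonneg) ENNReal.toReal_nonneg
      (fun j hj => by
        -- local-energy estimate at `(s j, θ)`
        have H := hLE Q 3 f u p G hsws (by norm_num) hfq hG z' (θ ^ j * r₀) θ (hs0 j) hθ hθhalf
          (hclQ' _ (hs0 j) (hsr₀ j))
        rw [hsucc j] at H
        exact real_localEnergy le_self_add H (by norm_num) (hAfin _ (hs0 j) (hsr₀ j))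
          (hEfin _ (hs0 j) (hsr₀ j)) (hDfin _ (hs0 j) (hsr₀ j)) (hFfin _ (hs0 j) (hsr₀ j)))
      (fun j hj => by
        -- pressure estimate at `(s j, θ)`
        have H := hPE Q f u p G hsws hfli hdiv hG z' (θ ^ j * r₀) θ (hs0 j) hθ hθhalf
          (hclQ' _ (hs0 j) (hsr₀ j))
        rw [hsucc j] at H
        exact real_pressure hθ hθ1 H (hAfin _ (hs0 j) (hsr₀ j)) (hEfin _ (hs0 j) (hsr₀ j))
          (hDfin _ (hs0 j) (hsr₀ j)))
      (by
        -- interpolation at the last scale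
        exact real_interpolation (hIE u G z' (θ ^ k * r₀) (hs0 k) (hGr _ (hs0 k) (hsr₀ k))
          (hAfin _ (hs0 k) (hsr₀ k)) (hEfin _ (hs0 k) (hsr₀ k))) (hAfin _ (hs0 k) (hsr₀ k))
          (hEfin _ (hs0 k) (hsr₀ k)))
      hEsmall
      (fun j hj => by
        -- force smallness below the radius `r_F`
        exact real_force (q := 3) (by norm_num) hη.le
          (((hFle _ (hs0 j) (hsr₀ j)).le.trans (min_le_left _ _))))
      (by
        -- the a-priori bound at `r₀`
        have e0 : θ ^ 0 * r₀ = r₀ := by simp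
        simp only [e0]
        have hA0 : cknAEss r₀ z' u ≤ (ENNReal.ofReal r₀)⁻¹ * CE := hAle r₀ hr₀ le_rfl
        have hD0 : cknD r₀ z' p ^ (4 / 3 : ℝ) ≤ (((ENNReal.ofReal r₀) ^ 2)⁻¹ * Np) ^ (4 / 3 : ℝ) :=
          ENNReal.rpow_le_rpow (cknD_le_of_subset p (hsubQ r₀ hr₀ le_rfl)) (by norm_num)
        have hfinA : (ENNReal.ofReal r₀)⁻¹ * (CE : ℝ≥0∞) ≠ ⊤ :=
          ENNReal.mul_ne_top (ENNReal.inv_ne_top.2 (ENNReal.ofReal_pos.2 hr₀).ne') ENNReal.coe_ne_top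
        have hfinD : (((ENNReal.ofReal r₀) ^ 2)⁻¹ * Np) ^ (4 / 3 : ℝ) ≠ ⊤ :=
          ENNReal.rpow_ne_top_of_nonneg (by norm_num) (ENNReal.mul_ne_top
            (ENNReal.inv_ne_top.2 (pow_ne_zero 2 (ENNReal.ofReal_pos.2 hr₀).ne')) hp'.ne)
        exact add_le_add (ENNReal.toReal_mono hfinA hA0) (ENNReal.toReal_mono hfinD hD0))
    -- back to `ℝ≥0∞`
    beta_reduce at hmain
    rw [← hrfdef] at hmain
    exact add_le_ofReal_of_real (hCfin rf hrf hrfr₀) (hDfin rf hrf hrfr₀) hmain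
  -- ## smallness at the point `(t, x)` itself: exhaust `Q_rf(t, x)` by the truncated cylinders
  -- `(t - rf², t - hₙ) × B(x, rf) ⊆ Q_rf(t - hₙ, x)`, `hₙ ↓ 0`
  set c₁ : ℝ := min (r₁ ^ 2) (3 * rf ^ 2) with hc₁
  have hc₁0 : 0 < c₁ := lt_min (by positivity) (by positivity)
  set hs : ℕ → ℝ := fun n => c₁ / ((n : ℝ) + 1) with hhs
  have hhs0 : ∀ n, 0 < hs n := fun n => by positivity
  have hhsc : ∀ n, hs n ≤ c₁ := fun n => by
    rw [hhs]
    exact div_le_self hc₁0.le (by linarith [n.cast_nonneg (α := ℝ)])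
  set A : ℕ → Set (ℝ × EuclideanSpace ℝ (Fin 3)) :=
    fun n => Ioo (t - rf ^ 2) (t - hs n) ×ˢ ball x rf with hA
  have hAmono : Monotone A := by
    intro m n hmn
    refine prod_mono (Ioo_subset_Ioo le_rfl ?_) Subset.rfl
    have : hs n ≤ hs m := by
      rw [hhs]
      exact div_le_div_of_nonneg_left hc₁0.le (by positivity) (by exact_mod_cast Nat.succ_le_succ hmn)
    linarith
  have hAsub : ∀ n, A n ⊆ parabolicCylinder rf (t - hs n, x) := by
    intro n
    rw [parabolicCylinder]
    refine prod_mono (Ioo_subset_Ioo ?_ le_rfl) Subset.rfl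
    simp only
    linarith [hhs0 n]
  have hAU : (⋃ n, A n) = parabolicCylinder rf (t, x) := by
    ext w
    simp only [mem_iUnion, hA, parabolicCylinder, mem_prod, mem_Ioo]
    constructor
    · rintro ⟨n, ⟨h1, h2⟩, h3⟩
      exact ⟨⟨h1, by linarith [hhs0 n]⟩, h3⟩
    · rintro ⟨⟨h1, h2⟩, h3⟩
      obtain ⟨n, hn⟩ := exists_nat_gt (c₁ / (t - w.1))
      refine ⟨n, ⟨h1, ?_⟩, h3⟩
      have hgap : 0 < t - w.1 := sub_pos.2 h2
      have : hs n < t - w.1 := by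
        rw [hhs, div_lt_iff₀ (by positivity)]
        have := (div_lt_iff₀ hgap).1 hn
        nlinarith
      linarith
  have hsmallz : cknC rf (t, x) u + cknD rf (t, x) p ≤ ENNReal.ofReal (εL ^ 3) := by
    have hdir : Directed (· ⊆ ·) A := hAmono.directed_le
    have eC : cknC rf (t, x) u = ⨆ n, (ENNReal.ofReal rf ^ 2)⁻¹ *
        (∫⁻ w in A n, ‖u w.1 w.2‖ₑ ^ (3 : ℕ)) := by
      rw [cknC, ← hAU, setLIntegral_iUnion_of_directed _ hdir, ENNReal.mul_iSup]
    have eD : cknD rf (t, x) p = ⨆ n, (ENNReal.ofReal rf ^ 2)⁻¹ *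
        (∫⁻ w in A n, ‖p w.1 w.2‖ₑ ^ (3 / 2 : ℝ)) := by
      rw [cknD, ← hAU, setLIntegral_iUnion_of_directed _ hdir, ENNReal.mul_iSup]
    rw [eC, eD]
    refine ENNReal.iSup_add_iSup_le fun i j => ?_
    have hi : A i ⊆ parabolicCylinder rf (t - hs (max i j), x) :=
      (hAmono (le_max_left i j)).trans (hAsub _)
    have hj : A j ⊆ parabolicCylinder rf (t - hs (max i j), x) :=
      (hAmono (le_max_right i j)).trans (hAsub _)
    calc (ENNReal.ofReal rf ^ 2)⁻¹ * (∫⁻ w in A i, ‖u w.1 w.2‖ₑ ^ (3 : ℕ)) +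
          (ENNReal.ofReal rf ^ 2)⁻¹ * (∫⁻ w in A j, ‖p w.1 w.2‖ₑ ^ (3 / 2 : ℝ))
        ≤ cknC rf (t - hs (max i j), x) u + cknD rf (t - hs (max i j), x) p :=
          add_le_add (mul_le_mul_right (lintegral_mono_set hi) _)
            (mul_le_mul_right (lintegral_mono_set hj) _)
      _ ≤ ENNReal.ofReal (εL ^ 3) := hstep (hs (max i j)) (hhs0 _)
          ((hhsc _).trans (min_le_left _ _)) ((hhsc _).trans (min_le_right _ _))
  -- ## the one-scale criterion on the top cylinder `Q_rf(t, x)`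
  have hsubz : parabolicCylinder rf (t, x) ⊆ (Q : Set (ℝ × EuclideanSpace ℝ (Fin 3))) := by
    rw [hQ, parabolicCylinder, parabolicCylinder]
    refine prod_mono ?_ (ball_subset_ball' (by simp only; linarith))
    simp only
    have : rf ^ 2 ≤ r₁ ^ 2 := pow_le_pow_left₀ hrf.le hrfr₁ 2
    exact Ioo_subset_Ioo (by nlinarith) hzt.2
  have hmeas_u : AEMeasurable (fun w : ℝ × EuclideanSpace ℝ (Fin 3) => ‖u w.1 w.2‖ₑ ^ (3 : ℕ))
      (volume.restrict (parabolicCylinder rf (t, x))) := by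
    have h1 : AEStronglyMeasurable (uncurry u) (volume.restrict (parabolicCylinder rf (t, x))) :=
      hsws.distributional.1.aestronglyMeasurable.mono_measure (Measure.restrict_mono hsubz le_rfl)
    exact (h1.aemeasurable.enorm.pow_const 3)
  have hint : ∫⁻ w in parabolicCylinder rf (t, x),
      (‖u w.1 w.2‖ₑ ^ (3 : ℕ) + ‖p w.1 w.2‖ₑ ^ (3 / 2 : ℝ)) ≤ ENNReal.ofReal (εL ^ 3 * rf ^ 2) := by
    rw [lintegral_add_left' hmeas_u]
    have hc0 : (ENNReal.ofReal rf ^ 2) ≠ 0 := pow_ne_zero 2 (ENNReal.ofReal_pos.2 hrf).ne'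
    have hctop : (ENNReal.ofReal rf ^ 2) ≠ ⊤ := ENNReal.pow_ne_top ENNReal.ofReal_ne_top
    have h1 : (ENNReal.ofReal rf ^ 2)⁻¹ *
        ((∫⁻ w in parabolicCylinder rf (t, x), ‖u w.1 w.2‖ₑ ^ (3 : ℕ)) +
          (∫⁻ w in parabolicCylinder rf (t, x), ‖p w.1 w.2‖ₑ ^ (3 / 2 : ℝ))) ≤
        ENNReal.ofReal (εL ^ 3) := by
      rw [mul_add]
      exact hsmallz
    have h2 := mul_le_mul_right h1 (ENNReal.ofReal rf ^ 2)
    rw [← mul_assoc, ENNReal.mul_inv_cancel hc0 hctop, one_mul] at h2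
    refine h2.trans (le_of_eq ?_)
    rw [← ENNReal.ofReal_pow hrf.le, ← ENNReal.ofReal_mul (by positivity), mul_comm]
  -- the force condition of Thm. 14.4 at the last scale: `∫∫_{Q_rf(t,x)} |f|³ ≤ εL⁶ rf⁻⁴`
  have hforce : ∫⁻ w in parabolicCylinder rf (t, x), ‖f w.1 w.2‖ₑ ^ (3 : ℝ) ≤
      ENNReal.ofReal (εL ^ (2 * (3 : ℝ)) * rf ^ (5 - 3 * (3 : ℝ))) := by
    set I : ℝ≥0∞ := ∫⁻ w in parabolicCylinder rf (t, x), ‖f w.1 w.2‖ₑ ^ (3 : ℝ) with hI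
    have hpow : 0 < rf ^ (3 * (3 : ℝ) - 5) := Real.rpow_pos_of_pos hrf _
    have h1 : ENNReal.ofReal (rf ^ (3 * (3 : ℝ) - 5)) * I < ENNReal.ofReal (εL ^ 6) :=
      lt_of_le_of_lt (mul_le_mul_right (lintegral_mono_set hsubz) _)
        ((hFlt rf hrf (lt_of_le_of_lt hrfr₀ hr₀F)).trans_le (min_le_right _ _))
    have h2 : I ≤ ENNReal.ofReal (εL ^ 6) / ENNReal.ofReal (rf ^ (3 * (3 : ℝ) - 5)) := by
      rw [mul_comm] at h1
      exact ((ENNReal.lt_div_iff_mul_lt (Or.inl (ENNReal.ofReal_pos.2 hpow).ne')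
        (Or.inl ENNReal.ofReal_ne_top)).2 h1).le
    refine h2.trans (le_of_eq ?_)
    rw [← ENNReal.ofReal_div_of_pos hpow]
    congr 1
    have e1 : εL ^ (2 * (3 : ℝ)) = εL ^ 6 := by
      rw [show (2 * (3 : ℝ)) = ((6 : ℕ) : ℝ) by norm_num, Real.rpow_natCast]
    have e2 : rf ^ (5 - 3 * (3 : ℝ)) = (rf ^ (3 * (3 : ℝ) - 5))⁻¹ := by
      rw [← Real.rpow_neg hrf.le]
      congr 1
      ring
    rw [e1, e2, div_eq_mul_inv]
  have hbdd := hLR Q f u p G hS ((t : ℝ), x) rf εL hrf hsubz hεL.le le_rfl hint hforce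
  refine ⟨rf / 2, by positivity, ?_⟩
  rw [eLpNorm_exponent_top]
  exact eLpNormEssSup_lt_top_of_ae_bound (C := CL * εL / rf) hbdd

/-- **Tsai 1998, Lemma 4.2 with a solenoidal `L³` force, unit viscosity** — the previous theorem
with the four Caffarelli–Kohn–Nirenberg estimates supplied by their tree discharges
(`localEnergyEstimate_holds`, `pressureEstimate_holds`, `interpolationEstimate_holds`,
`lemarieRieusset_epsilon_regularity_holds`): no hypotheses beyond the datum.
[cite: Tsai1998, Lemma 4.2 (p. 46)] [cite: CaffarelliKohnNirenberg1982, Proposition 2] -/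
theorem tsai1998_lemma42_forced_unit :
    ∃ ε : ℝ, 0 < ε ∧
    ∀ (ρ T : ℝ) (x₀ : EuclideanSpace ℝ (Fin 3))
      (f u : ℝ → EuclideanSpace ℝ (Fin 3) → EuclideanSpace ℝ (Fin 3))
      (p : ℝ → EuclideanSpace ℝ (Fin 3) → ℝ)
      (G : ℝ → EuclideanSpace ℝ (Fin 3) → EuclideanSpace ℝ (Fin 3) →L[ℝ] EuclideanSpace ℝ (Fin 3)),
      0 < ρ →
      IsLRSuitableWeakSolutionOn (parabolicCylinderOpens ρ (T, x₀)) 1 3 f u p G →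
      (∀ φ : ℝ → EuclideanSpace ℝ (Fin 3) → ℝ,
        IsSpaceTimeTestOn (parabolicCylinderOpens ρ (T, x₀)) φ →
          ∫ t, ∫ x, ⟪f t x, gradient (φ t) x⟫ = 0) →
      ∀ z : ℝ × EuclideanSpace ℝ (Fin 3), z.1 ∈ Ioc (T - ρ ^ 2) T → z.2 ∈ ball x₀ ρ →
        limsup (fun r : ℝ => (ENNReal.ofReal r)⁻¹ *
            ∫⁻ w in parabolicCylinder r z, ENNReal.ofReal (frobeniusNormSq (G w.1 w.2)))
          (𝓝[>] (0 : ℝ)) ≤ ENNReal.ofReal ε →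
        ∃ r₁ : ℝ, 0 < r₁ ∧
          eLpNorm (uncurry u) ⊤ (volume.restrict (parabolicCylinder r₁ z)) < ⊤ :=
  tsai1998_lemma42_forced_unit_of_estimates localEnergyEstimate_holds pressureEstimate_holds
    interpolationEstimate_holds lemarieRieusset_epsilon_regularity_holds

end Literature.Analysis.FluidPDE

end
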